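import Literature.MathematicalPhysics.QuantumFieldTheory.Balaban1983to89.B8Thm2TorusKnitEstimatesOfMajorants
import Literature.MathematicalPhysics.QuantumFieldTheory.Balaban1983to89.B9B8KnitLetterTau

/-!
# `Balaban1983to89.B8Thm2TorusLettersTauOfKnit` — M5.9 ASSEMBLY, FILE A5: the `τ`-laws of the v3 letters of [Balaban1985RegularSpaces] Thm 2 on `T_η`
# DISCHARGED at [Balaban1985BackgroundPropagators]'s objects (junction file 21 `B9B8KnitLetterTau`): `G′`, `H′ = G′²Q′*C`, `R = I − G′Q′ᵀCQ′G′` map `τ`-free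
# data to `τ`-free values for every tracial `τ` — so at `G = SU(N)`, `τ = tr`, the trace-law hypothesis of the G-B8-T2S endpoint disappears

statement-level skeleton of published theorems with citation tags; proofs where landed; nothing here is a claim about the
Yang–Mills mass gap

T. Bałaban, *Spaces of regular gauge field configurations on a lattice and gauge fixing conditions*, Commun. Math. Phys. **99** (1985) 75–102
[`Balaban1985RegularSpaces`, "[B8]"]: p. 76 (*«𝔤 = su(N)»*, the Lie-algebra-valued fields: trace-free hermitian matrices), Thm 2 p. 83, (1.91) p. 91, (1.95)–(1.98) p. 92.
T. Bałaban, *Propagators for lattice gauge theories in a background field*, Commun. Math. Phys. **99** (1985) 389–434 [`Balaban1985BackgroundPropagators`, "[4]"]: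
(3.19)–(3.25) pp. 393–395, p. 391 (*«functions with values in N × N hermitian matrices»*).  STATUS: published, refereed.

CITATION HEADER (lean-in-tree rule).  Cell `lit-balaban`, seat `lit-balaban-t2s-1` (gen 4), MODULE M5.9 of the G-B9-LETTERS map of record, file A5; sub-row
G-B8-T2S (R3 `stmt-QuantumFields-19200`, helper).  CONSUMED BY NAME: junction J-B file 21 (seat p33 gen 95) `B9B8KnitLetterTau.GpKnitY_tau` ∕ `Hprime_parKnitY_tau` ∕
`RY_parKnitY_tau` (every letter of [4] §3 commutes with `a ↦ τ(a)·1` for a tracial `τ`, hence preserves `τ`-freeness); J-B 12 `B9B8KnitLetterProjectionC.RY_parKnitY_smul`;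
`B8SpecialUnitaryTrace.trCLM_mul_comm`; files A2–A4 of this seat.

WHAT THIS FILE PROVES (sorry-free; no definitions; nothing of [B8]∕[4]'s estimates asserted).
* §1 ★★ `knitLettersYTau_ofParKnitY` — file A2's displayed `KnitLettersYTau τ` HOLDS for the junction's letters at every member ∕ background, for every `τ` with
  `τ(xy) = τ(yx)` (`N ≥ 1`); `knitLettersYTau_familyOfInAk`, `knitLettersYTau_familyAt` (the families of file A3).
* §2 ★★★ `lettersAllPerTau_ofParKnitY_tracial` — the `τ`-laws binder `LettersAllPerTau τ` of file A3's binder with NO `τ`-hypothesis left; `lettersAllPerTau_ofMajorants`.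
* §3 ★★★★★★ **`thm2TorusAt_specialUnitary_ofMajorants_tr`** — file A4's composed endpoint with the trace-law hypothesis (iv) DISCHARGED (`τ = tr`,
  `Matrix.trace_mul_comm`): [B8] Thm 2 on `T_η` for `SU(N)`, `N ≤ 25`, its Landau-gauge letters being [4]'s operators at print's transporters, GIVEN (i) the member
  catalogue, (ii) the [4] Thm 3.1∕3.2-type block majorants at every member and background (M5.5∕M5.6's output shapes at `parKnitY`), (iii) the (B)-lines (M5.7–8).

HONEST SCOPE.  Algebra only (no estimate): (i)–(iii) stay displayed, inhabited by nothing here; count-neutral; N05 ∕ `stub_PV3A` NOT discharged; nothing continuum ∕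
ℝ⁴ ∕ OS ∕ mass-gap ∕ Clay — the Yang–Mills mass gap is NOT proved.  No `sorry`, no `axiom`, no `… : Prop` fact, no `instance`, no `notation`.  NEW file; nothing
landed is modified.  Seat `lit-balaban-t2s-1` gen 4, 2026-08-28.
-/

noncomputable section

open scoped BigOperators

namespace Literature.MathematicalPhysics.QuantumFieldTheory.Balaban1983to89.B8Thm2TorusLettersTauOfKnit

open Node00 B6KLevelCensusIndexV1 B9Eq39Adjoint
open B7Prop1Explicit renaming Site → LSite
open B7Prop1Explicit (e)
open B7Prop2Explicit (unitaryUnits AvgClosed C0 c2')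
open B9Thm34Ext (toB6)
open B9GeoNormsKLevelV1 (geo9K)
open B8Ineq132 (InAk)
open B12Ineq417Flat (shiftCfg shiftCfg_apply)
open B8Thm4TorusAt (torusLam)
open B8Thm2TorusAt (Thm2TorusAt)
open B8Thm2TorusLettersPer (LettersAllPer LettersAllPerTau)
open B6GlobalChartV1 (PV)
open B9B8AveragingJunction (parKnitY)
open B9Thm311PositivityKnitLetter (GpKnitY)
open B8Thm2TorusLettersPerOfKnit (bgY KnitLettersY KnitLettersYTau knitLettersY_ofParKnitY shiftCfg_U₀)
open B8Thm2TorusLettersAllPerOfKnit (knitLettersY_familyOfInAk knitLettersY_familyAt lettersAllPer_ofParKnitY lettersAllPerTau_ofParKnitY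
  parKnitY_mem_of_inAk inAk_univ_of_le threshold3_of_le threshold2_of_le)
open B8Thm2TorusKnitEstimatesOfMajorants (RY_knit_apply KnitConstants KnitMajorants B9P3PerAt knitEstimates_familyAt_of_majorants lettersAllPer_ofMajorants)
open B9B8KnitLetterTau (GpKnitY_tau Hprime_parKnitY_tau RY_parKnitY_tau)
open B9B8KnitLetterProjectionC (RY_parKnitY_smul)
open B7Prop2SpecialUnitary (specialUnitaryUnits specialUnitaryUnits_le_unitaryUnits)
open B7AvgClosedSpecialUnitarySharp (avgClosed_specialUnitary_of_le)
open B8SpecialUnitaryTrace (trCLM trCLM_mul_comm)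
open B8Thm2TorusAtOfLettersPerB9 (thm2TorusAt_specialUnitary_of_lettersPerB9)
open scoped Matrix Matrix.Norms.L2Operator

variable {d ℓ : ℕ} {hd : 1 ≤ d + 1} {hL : Odd (ℓ + 1) ∧ 1 < ℓ + 1} {b₀ b₁ : ℝ}
variable {N : ℕ} [NeZero N] (τ : Matrix (Fin N) (Fin N) ℂ →L[ℂ] ℂ) (hτ : ∀ x y : Matrix (Fin N) (Fin N) ℂ, τ (x * y) = τ (y * x))
variable {G : Subgroup (Matrix (Fin N) (Fin N) ℂ)ˣ}

/-! ## §1 The def-Y-side `τ`-laws hold at the junction's letters -/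

include hτ in
/-- ★★ **FILE A2's DISPLAYED `KnitLettersYTau τ` HOLDS AT THE JUNCTION's LETTERS** (every constant-level member, every background of A2's hypotheses, every tracial
`τ`, `N ≥ 1`): `G′ = η²G′(U; parKnitY)`, `H′ = G′²Q′*(Q′G′²Q′*)⁻¹`, `R = I − G′Q′*CQ′G′` map `τ`-free data to `τ`-free values — junction file 21's `GpKnitY_tau`,
`Hprime_parKnitY_tau`, `RY_parKnitY_tau` (with J-B 12's `RY_parKnitY_smul`: `R` is blind to the units of `G′`).
[cite: Balaban1985RegularSpaces, p.76 («𝔤»), (1.91) p.91, (1.95)–(1.98) p.92; Balaban1985BackgroundPropagators, (3.19)–(3.25) pp.393–395, p.391] -/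
theorem knitLettersYTau_ofParKnitY (i : KIdx d ℓ hd hL b₀ b₁) {n : ℕ} (hlev : ∀ z : SiteY i, levY i z = n)
    (hG : G ≤ unitaryUnits (Matrix (Fin N) (Fin N) ℂ)) {U₀ : LSite (d + 1) → Fin (d + 1) → (Matrix (Fin N) (Fin N) ℂ)ˣ} (hU₀G : ∀ x μ, U₀ x μ ∈ G)
    (hU₀per : ∀ μ : Fin (d + 1), shiftCfg ((((PV d ℓ i.m i.K hd hL).sitesPerDir 0 : ℕ) : ℤ) • e μ) U₀ = U₀)
    (hpar : ∀ z w : SiteY i, parKnitY i (bgY i U₀) z w ∈ G) {η : ℝ} (hη : η ≠ 0) :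
    KnitLettersYTau τ (knitLettersY_ofParKnitY i hlev hG hU₀G hU₀per hpar hη) := by
  haveI : Nonempty (Fin N) := ⟨⟨0, Nat.pos_of_ne_zero (NeZero.ne N)⟩⟩
  have hc : ((((η * η : ℝ)) : ℂ)) ≠ 0 := Complex.ofReal_ne_zero.mpr (mul_ne_zero hη hη)
  exact
  { h_tau := fun Y hY z => Hprime_parKnitY_tau τ hτ i (bgY i U₀) hY z
    g_tau := fun Λ hΛ z => GpKnitY_tau τ hτ i (bgY i U₀) η hΛ z
    r_tau := fun Φ hΦ z => by
      have h := RY_parKnitY_tau τ hτ i (bgY i U₀) hΦ z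
      rw [← RY_parKnitY_smul i (bgY i U₀) hc, RY_knit_apply] at h
      exact h }

include hτ in
/-- the same for file A3's family `knitLettersY_familyOfInAk` (truncation `m`). [cite: Balaban1985RegularSpaces, p.76, (1.91)–(1.98) pp.91–92] -/
theorem knitLettersYTau_familyOfInAk (mem : ℕ → KIdx d ℓ hd hL b₀ b₁) {m : ℕ} {P : ℤ}
    (hP : ∀ n, 1 ≤ n → n ≤ m → (((PV d ℓ (mem n).m (mem n).K hd hL).sitesPerDir 0 : ℕ) : ℤ) = P)
    (hlev : ∀ n, 1 ≤ n → n ≤ m → ∀ z : SiteY (mem n), levY (mem n) z = n)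
    (hG : G ≤ unitaryUnits (Matrix (Fin N) (Fin N) ℂ)) (hGa : AvgClosed (d + 1) (ℓ + 1) G)
    {U₀ : LSite (d + 1) → Fin (d + 1) → (Matrix (Fin N) (Fin N) ℂ)ˣ} (hU₀G : ∀ x μ, U₀ x μ ∈ G)
    (hU₀per : ∀ (x : LSite (d + 1)) (μ : Fin (d + 1)), U₀ (x + P • e μ) = U₀ x)
    {η α₀ : ℝ} (hη : η ≠ 0) (hα : 0 < α₀) (hα3 : C0 (d + 1) * α₀ ≤ 1 / 3) (hα2 : 2 * α₀ ≤ c2' (d + 1) (ℓ + 1))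
    (hA : InAk (ℓ + 1) m η α₀ (fun _ => (Set.univ : Set (LSite (d + 1)))) U₀) (n : ℕ) (hn : 1 ≤ n) (hnm : n ≤ m) :
    KnitLettersYTau τ (knitLettersY_familyOfInAk mem hP hlev hG hGa hU₀G hU₀per hη hα hα3 hα2 hA n hn hnm) := by
  have hper : ∀ μ : Fin (d + 1), shiftCfg ((((PV d ℓ (mem n).m (mem n).K hd hL).sitesPerDir 0 : ℕ) : ℤ) • e μ) U₀ = U₀ :=
    fun μ => funext fun x => by rw [shiftCfg_apply, hP n hn hnm, hU₀per]
  exact knitLettersYTau_ofParKnitY τ hτ (mem n) (hlev n hn hnm) hG hU₀G hper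
    (parKnitY_mem_of_inAk (mem n) (hlev n hn hnm) hn hGa hU₀G hper hα hα3 hα2 (inAk_univ_of_le hnm hA)) hη

include hτ in
/-- the same for file A3's binder family `knitLettersY_familyAt` — EXACTLY the trace-law hypothesis of `thm2TorusAt_specialUnitary_ofParKnitY` ∕ `…_ofMajorants`.
[cite: Balaban1985RegularSpaces, p.76, (1.91)–(1.98) pp.91–92] -/
theorem knitLettersYTau_familyAt (mem : ℕ → KIdx d ℓ hd hL b₀ b₁) {k : ℕ} {P : ℤ}
    (hP : ∀ n, 1 ≤ n → n ≤ k → (((PV d ℓ (mem n).m (mem n).K hd hL).sitesPerDir 0 : ℕ) : ℤ) = P)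
    (hlev : ∀ n, 1 ≤ n → n ≤ k → ∀ z : SiteY (mem n), levY (mem n) z = n)
    (hG : G ≤ unitaryUnits (Matrix (Fin N) (Fin N) ℂ)) (hGa : AvgClosed (d + 1) (ℓ + 1) G)
    {η : ℝ} (hη : η ≠ 0) {cL : ℝ} (hc3 : C0 (d + 1) * cL ≤ 1 / 3) (hc2 : 2 * cL ≤ c2' (d + 1) (ℓ + 1)) :
    ∀ (m : ℕ) (hm : m ≤ k) (α₀ : ℝ) (hα : 0 < α₀) (hc : α₀ ≤ cL) (U₀ : LSite (d + 1) → Fin (d + 1) → (Matrix (Fin N) (Fin N) ℂ)ˣ)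
      (hU₀G : ∀ x κ, U₀ x κ ∈ G) (hU₀per : ∀ (x : LSite (d + 1)) (μ : Fin (d + 1)), U₀ (x + P • e μ) = U₀ x)
      (hA : InAk (ℓ + 1) m η α₀ (fun _ => (Set.univ : Set (LSite (d + 1)))) U₀),
      ∀ n (hn : 1 ≤ n) (hnm : n ≤ m), KnitLettersYTau τ (knitLettersY_familyAt mem hP hlev hG hGa hη hc3 hc2 hm hα hc hU₀G hU₀per hA n hn hnm) :=
  fun _ hm _ hα hc _ hU₀G hU₀per hA n hn hnm =>
    knitLettersYTau_familyOfInAk τ hτ mem (fun n hn hnm => hP n hn (hnm.trans hm)) (fun n hn hnm => hlev n hn (hnm.trans hm)) hG hGa hU₀G hU₀per hη hα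
      (threshold3_of_le hc hc3) (threshold2_of_le hc hc2) hA n hn hnm

/-! ## §2 The `τ`-laws binder with no `τ`-hypothesis left -/

include hτ in
/-- ★★★ **THE `τ`-LAWS BINDER `LettersAllPerTau τ` OF FILE A3's BINDER, FOR EVERY TRACIAL `τ`, NO DISPLAYED `τ`-HYPOTHESIS** (whatever the estimate bundle `est`).
[cite: Balaban1985RegularSpaces, Thm 2 p.83, p.76, (1.91)–(1.98) pp.91–92; Balaban1985BackgroundPropagators, (3.19)–(3.25) pp.393–395] -/
theorem lettersAllPerTau_ofParKnitY_tracial (mem : ℕ → KIdx d ℓ hd hL b₀ b₁) {k : ℕ} {P : ℤ}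
    (hP : ∀ n, 1 ≤ n → n ≤ k → (((PV d ℓ (mem n).m (mem n).K hd hL).sitesPerDir 0 : ℕ) : ℤ) = P)
    (hlev : ∀ n, 1 ≤ n → n ≤ k → ∀ z : SiteY (mem n), levY (mem n) z = n)
    (hG : G ≤ unitaryUnits (Matrix (Fin N) (Fin N) ℂ)) (hGa : AvgClosed (d + 1) (ℓ + 1) G)
    {η : ℝ} (hη : η ≠ 0) {cL : ℝ} (hc3 : C0 (d + 1) * cL ≤ 1 / 3) (hc2 : 2 * cL ≤ c2' (d + 1) (ℓ + 1))
    {BG BR B₀'H B₂' B₀ B₀β cB β : ℝ} {len : LSite (d + 1) → ℝ}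
    (est : letI : CStarAlgebra (Matrix (Fin N) (Fin N) ℂ) := {}
      ∀ (m : ℕ) (hm : m ≤ k) (α₀ : ℝ) (hα : 0 < α₀) (hc : α₀ ≤ cL) (U₀ : LSite (d + 1) → Fin (d + 1) → (Matrix (Fin N) (Fin N) ℂ)ˣ)
        (hU₀G : ∀ x κ, U₀ x κ ∈ G) (hU₀per : ∀ (x : LSite (d + 1)) (μ : Fin (d + 1)), U₀ (x + P • e μ) = U₀ x)
        (hA : InAk (ℓ + 1) m η α₀ (fun _ => (Set.univ : Set (LSite (d + 1)))) U₀),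
        B8Thm2TorusLettersPerOfKnit.KnitEstimates (𝔸 := Matrix (Fin N) (Fin N) ℂ) mem η U₀
          (knitLettersY_familyAt mem hP hlev hG hGa hη hc3 hc2 hm hα hc hU₀G hU₀per hA) (ℓ + 1) BG BR B₀'H B₂' B₀ B₀β cB β len α₀ P) :
    letI : CStarAlgebra (Matrix (Fin N) (Fin N) ℂ) := {}
    LettersAllPerTau (𝔸 := Matrix (Fin N) (Fin N) ℂ) τ (lettersAllPer_ofParKnitY mem hP hlev hG hGa hη hc3 hc2 est) :=
  lettersAllPerTau_ofParKnitY τ mem hP hlev hG hGa hη hc3 hc2 est (knitLettersYTau_familyAt τ hτ mem hP hlev hG hGa hη hc3 hc2)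

include hτ in
/-- ★★★ the `τ`-laws binder of file A4's `lettersAllPer_ofMajorants`, for every tracial `τ`. [cite: Balaban1985RegularSpaces, Thm 2 p.83, p.76, (1.91)–(1.98) pp.91–92] -/
theorem lettersAllPerTau_ofMajorants (mem : ℕ → KIdx d ℓ hd hL b₀ b₁) [∀ n, Fintype (geo9K (mem n)).Site]
    [∀ n, DecidableEq (geo9K (mem n)).Site] {k : ℕ} {P : ℤ}
    (hP : ∀ n, 1 ≤ n → n ≤ k → (((PV d ℓ (mem n).m (mem n).K hd hL).sitesPerDir 0 : ℕ) : ℤ) = P)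
    (hlev : ∀ n, 1 ≤ n → n ≤ k → ∀ z : SiteY (mem n), levY (mem n) z = n)
    (hG : G ≤ unitaryUnits (Matrix (Fin N) (Fin N) ℂ)) (hGa : AvgClosed (d + 1) (ℓ + 1) G)
    {η : ℝ} (hη : 0 < η) {cL : ℝ} (hc3 : C0 (d + 1) * cL ≤ 1 / 3) (hc2 : 2 * cL ≤ c2' (d + 1) (ℓ + 1))
    {ι : Type} [Fintype ι] {b : Module.Basis ι ℝ (Matrix (Fin N) (Fin N) ℂ)} {M₂ δ₀ δ βx ρ A A₁ K c : ℝ} {d₁ : ℕ}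
    (cst : KnitConstants b M₂ δ₀ δ βx ρ A A₁ K)
    {ιB : ∀ n, BlkY (mem n) → IBondY (mem n)} {Rr : ℝ} {Hp : Prop} {s : ℕ → ℝ}
    (maj : ∀ n, 1 ≤ n → n ≤ k → ∀ ⦃α₀ : ℝ⦄, 0 < α₀ → α₀ ≤ cL → ∀ U₀ : LSite (d + 1) → Fin (d + 1) → (Matrix (Fin N) (Fin N) ℂ)ˣ,
      (∀ x κ, U₀ x κ ∈ G) → (∀ (x : LSite (d + 1)) (μ : Fin (d + 1)), U₀ (x + P • e μ) = U₀ x) →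
      InAk (ℓ + 1) n η α₀ (fun _ => (Set.univ : Set (LSite (d + 1)))) U₀ →
      KnitMajorants (mem n) (bgY (mem n) U₀) b (ιB n) Rr Hp d₁ δ₀ δ βx ρ A A₁ K c (s n))
    {BG BR B₀'H B₂' B₀ B₀β cB β : ℝ} {len : LSite (d + 1) → ℝ}
    (hBG : (∑ j, ‖b j‖) * A * c * M₂ ≤ BG) (hBG₁ : (∑ j, ‖b j‖) * A₁ * c * M₂ ≤ BG)
    (hBH : (∑ j, ‖b j‖) * (((M₂ * ∑ j, ‖b j‖) * A * A * K * B6.c1 d₁ δ₀ βx ^ 2) * c * M₂) ≤ B₀'H)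
    (hBH₁ : (∑ j, ‖b j‖) * (((M₂ * ∑ j, ‖b j‖) * A₁ * A * K * B6.c1 d₁ δ₀ βx ^ 2) * c * M₂) ≤ B₀'H)
    (hB₂ : (∑ j, ‖b j‖) * (((M₂ * ∑ j, ‖b j‖) * A * K * B6.c1 d₁ δ₀ βx) * c * M₂)
        + (∑ j, ‖b j‖) * (((M₂ * ∑ j, ‖b j‖) * A * A * K * B6.c1 d₁ δ₀ βx ^ 2) * c * M₂) ≤ B₂')
    (hBR : 1 + (∑ j, ‖b j‖) * (((M₂ * ∑ j, ‖b j‖) ^ 2 * A * K * A * B6.c1 d₁ δ₀ βx ^ 2) * c * M₂) ≤ BR)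
    (hb9 : letI : CStarAlgebra (Matrix (Fin N) (Fin N) ℂ) := {}
      ∀ m, m ≤ k → ∀ ⦃α₀ : ℝ⦄, 0 < α₀ → α₀ ≤ cL → ∀ U₀ : LSite (d + 1) → Fin (d + 1) → (Matrix (Fin N) (Fin N) ℂ)ˣ,
        (∀ x κ, U₀ x κ ∈ G) → (∀ (x : LSite (d + 1)) (μ : Fin (d + 1)), U₀ (x + P • e μ) = U₀ x) →
        InAk (ℓ + 1) m η α₀ (fun _ => (Set.univ : Set (LSite (d + 1)))) U₀ →
        B9P3PerAt (𝔸 := Matrix (Fin N) (Fin N) ℂ) (ℓ + 1) B₀ B₀β cB β len η m α₀ P U₀) :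
    letI : CStarAlgebra (Matrix (Fin N) (Fin N) ℂ) := {}
    LettersAllPerTau (𝔸 := Matrix (Fin N) (Fin N) ℂ) τ
      (lettersAllPer_ofMajorants mem hP hlev hG hGa hη hc3 hc2 cst maj hBG hBG₁ hBH hBH₁ hB₂ hBR hb9) :=
  lettersAllPerTau_ofParKnitY τ mem hP hlev hG hGa hη.ne' hc3 hc2 _ (knitLettersYTau_familyAt τ hτ mem hP hlev hG hGa hη.ne' hc3 hc2)

/-! ## §3 ★★★★★★ [B8] Thm 2 on `T_η` for `SU(N)` from the displayed majorants and (B)-lines — trace laws discharged -/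

/-- ★★★★★★ **[B8] THM 2 ON `T_η` FOR `SU(N)` (`N ≤ 25`), LANDAU-GAUGE LETTERS = [4]'s OPERATORS AT PRINT's TRANSPORTERS, TRACE LAWS DISCHARGED** (`τ = tr`,
`trCLM_mul_comm`): file A4's `thm2TorusAt_specialUnitary_ofMajorants` with hypothesis (iv) removed.  Uniform `B₂, c₁ > 0` such that for every `k ≥ 1`, `η > 0`,
`P ∈ LᵏZ` — GIVEN (i) the catalogue `memF k P n` of constant-level members on the torus of side `P`, (ii) for every member and every `SU(N)`-valued `P`-periodic
`U₀ ∈ 𝔄_n(T_η, α₀)`, `α₀ ≤ c_L`, the [4] Thm 3.1∕3.2-type block majorants `KnitMajorants` with uniform `KnitConstants` (M5.5∕M5.6's output shapes at `parKnitY`),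
(iii) the (B)-lines `B9P3PerAt` (M5.7–8) — `Thm2TorusAt (ℓ+1) k P η 0 B₁ B₂ c₁ len SU(N) ⊤` holds (endpoint windows on `B₀ … B₁`, `c_L` below [B7] Prop. 2's
thresholds, `B_G, B₀′ᴴ, B₂′, B_R` above the four explicit expressions).  HONEST SCOPE: (i)–(iii) displayed, inhabited by nothing here; count-neutral; `stub_PV3A` NOT
discharged; nothing continuum ∕ ℝ⁴ ∕ OS ∕ mass-gap ∕ Clay — the Yang–Mills mass gap is NOT proved.
[cite: Balaban1985RegularSpaces, Thm 2 p.83, Thm 4 p.88, (1.7) p.77, p.76, (1.91)–(1.98) pp.91–92, (1.101) p.93, (1.59) p.86; Balaban1985BackgroundPropagators, Thm 3.1 (3.42) p.397, Thm 3.2 (3.48) p.398, (3.19)–(3.25) pp.393–395, Thm 3.11 p.416; Balaban1985Averaging, Prop. 2 p.26; Balaban1984PropagatorsII, (2.51)–(2.52) p.232, (2.61) p.234] -/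
theorem thm2TorusAt_specialUnitary_ofMajorants_tr (hN : N ≤ 25) (hd2 : 2 ≤ d + 1)
    {B₀ B₀' B₀'H B₂' BG BR B₀β cB9 β cL B₁ : ℝ} {len : LSite (d + 1) → ℝ}
    (hB₀ : 0 < B₀) (hB₀' : 0 < B₀') (hB : 2 ≤ 5 * ((d + 1 : ℕ) : ℝ) * ((ℓ + 1 : ℕ) : ℝ) * B₀) (hB₀'H : 0 < B₀'H) (hB₂' : 0 ≤ B₂') (hBG : 0 ≤ BG)
    (hBR : 0 ≤ BR) (hcB9 : 0 < cB9) (hcL : 0 < cL) (hfree : 3 * (2 * ((d + 1 : ℕ) : ℝ) * (((ℓ + 1 : ℕ) : ℝ)) ^ 2) * BG * (BR + 2) ≤ B₀')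
    (hB₁ : 5 * ((d + 1 : ℕ) : ℝ) * ((ℓ + 1 : ℕ) : ℝ) * B₀ * (1 + 11 * (((d + 1 : ℕ) : ℝ)) ^ 2) < B₁)
    (hc3 : C0 (d + 1) * cL ≤ 1 / 3) (hc2 : 2 * cL ≤ c2' (d + 1) (ℓ + 1))
    {ι : Type} [Fintype ι] {b : Module.Basis ι ℝ (Matrix (Fin N) (Fin N) ℂ)} {M₂ δ₀ δ βx ρ A A₁ K c : ℝ} {d₁ : ℕ}
    (cst : KnitConstants b M₂ δ₀ δ βx ρ A A₁ K)
    (hBGe : (∑ j, ‖b j‖) * A * c * M₂ ≤ BG) (hBG₁ : (∑ j, ‖b j‖) * A₁ * c * M₂ ≤ BG)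
    (hBH : (∑ j, ‖b j‖) * (((M₂ * ∑ j, ‖b j‖) * A * A * K * B6.c1 d₁ δ₀ βx ^ 2) * c * M₂) ≤ B₀'H)
    (hBH₁ : (∑ j, ‖b j‖) * (((M₂ * ∑ j, ‖b j‖) * A₁ * A * K * B6.c1 d₁ δ₀ βx ^ 2) * c * M₂) ≤ B₀'H)
    (hB₂ : (∑ j, ‖b j‖) * (((M₂ * ∑ j, ‖b j‖) * A * K * B6.c1 d₁ δ₀ βx) * c * M₂)
        + (∑ j, ‖b j‖) * (((M₂ * ∑ j, ‖b j‖) * A * A * K * B6.c1 d₁ δ₀ βx ^ 2) * c * M₂) ≤ B₂')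
    (hBRe : 1 + (∑ j, ‖b j‖) * (((M₂ * ∑ j, ‖b j‖) ^ 2 * A * K * A * B6.c1 d₁ δ₀ βx ^ 2) * c * M₂) ≤ BR)
    (memF : ℕ → ℤ → ℕ → KIdx d ℓ hd hL b₀ b₁) [∀ k P n, Fintype (geo9K (memF k P n)).Site] [∀ k P n, DecidableEq (geo9K (memF k P n)).Site]
    (ιBF : ∀ k P n, BlkY (memF k P n) → IBondY (memF k P n)) (Rr : ℝ) (Hp : Prop) (sF : ℕ → ℤ → ℕ → ℝ) :
    letI : CStarAlgebra (Matrix (Fin N) (Fin N) ℂ) := {}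
    ∃ B₂ c₁ : ℝ, 0 < B₂ ∧ 0 < c₁ ∧ ∀ (k : ℕ) (P : ℤ) (η : ℝ), 1 ≤ k → 0 < η → (∃ M : ℤ, P = ((ℓ + 1 : ℕ) : ℤ) ^ k * M) →
      (∀ n, 1 ≤ n → n ≤ k → (((PV d ℓ (memF k P n).m (memF k P n).K hd hL).sitesPerDir 0 : ℕ) : ℤ) = P) →
      (∀ n, 1 ≤ n → n ≤ k → ∀ z : SiteY (memF k P n), levY (memF k P n) z = n) →
      (∀ n, 1 ≤ n → n ≤ k → ∀ ⦃α₀ : ℝ⦄, 0 < α₀ → α₀ ≤ cL → ∀ U₀ : LSite (d + 1) → Fin (d + 1) → (Matrix (Fin N) (Fin N) ℂ)ˣ,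
          (∀ x κ, U₀ x κ ∈ specialUnitaryUnits (Fin N)) → (∀ (x : LSite (d + 1)) (μ : Fin (d + 1)), U₀ (x + P • e μ) = U₀ x) →
          InAk (ℓ + 1) n η α₀ (fun _ => (Set.univ : Set (LSite (d + 1)))) U₀ →
          KnitMajorants (memF k P n) (bgY (memF k P n) U₀) b (ιBF k P n) Rr Hp d₁ δ₀ δ βx ρ A A₁ K c (sF k P n)) →
      (∀ m, m ≤ k → ∀ ⦃α₀ : ℝ⦄, 0 < α₀ → α₀ ≤ cL → ∀ U₀ : LSite (d + 1) → Fin (d + 1) → (Matrix (Fin N) (Fin N) ℂ)ˣ,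
          (∀ x κ, U₀ x κ ∈ specialUnitaryUnits (Fin N)) → (∀ (x : LSite (d + 1)) (μ : Fin (d + 1)), U₀ (x + P • e μ) = U₀ x) →
          InAk (ℓ + 1) m η α₀ (fun _ => (Set.univ : Set (LSite (d + 1)))) U₀ →
          B9P3PerAt (𝔸 := Matrix (Fin N) (Fin N) ℂ) (ℓ + 1) B₀ B₀β cB9 β len η m α₀ P U₀) →
      Thm2TorusAt (ℓ + 1) k P η 0 B₁ B₂ c₁ len (specialUnitaryUnits (Fin N)) (fun _ => True) := by
  letI : CStarAlgebra (Matrix (Fin N) (Fin N) ℂ) := {}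
  obtain ⟨B₂, c₁, hB₂pos, hc₁, H⟩ :=
    thm2TorusAt_specialUnitary_of_lettersPerB9 (len := len) hN hd2 (L := ℓ + 1) hL.2 hB₀ hB₀' hB hB₀'H hB₂' hBG hBR hcB9 hcL hfree hB₁
  refine ⟨B₂, c₁, hB₂pos, hc₁, fun k P η hk hη hPk hP hlev hmaj hb9 => ?_⟩
  exact H k P η hk hη hPk
    (lettersAllPer_ofMajorants (memF k P) hP hlev specialUnitaryUnits_le_unitaryUnits (avgClosed_specialUnitary_of_le hN (d + 1) (ℓ + 1)) hη hc3 hc2 cst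
      hmaj hBGe hBG₁ hBH hBH₁ hB₂ hBRe hb9)
    (lettersAllPerTau_ofMajorants (trCLM (Fin N)) trCLM_mul_comm (memF k P) hP hlev specialUnitaryUnits_le_unitaryUnits
      (avgClosed_specialUnitary_of_le hN (d + 1) (ℓ + 1)) hη hc3 hc2 cst hmaj hBGe hBG₁ hBH hBH₁ hB₂ hBRe hb9)

end Literature.MathematicalPhysics.QuantumFieldTheory.Balaban1983to89.B8Thm2TorusLettersTauOfKnit

end
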